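import Summits.NavierStokesRegularity.NavierStokesRegularity.Theses.FilamentSkeletonRss

/-!
# Route `FilamentSkeletonRss` · Variant A1G CLAUSE MONOTONICITY (stmt-NavierStokesRegularity-27849 / 27853)

The rev-22 cone-thinness retype A1G = A1α + ONE constant `KA` + ONE hypothesis clause (d7)
`Rw²·Γ·Aa j τ ≤ KA·(Rw²·Γ + ‖X j τ‖²)` threaded on BOTH sides of the cone.  Hence, by dropping the clause:

* `skeletonJ1_of_J1G : SkeletonJ1G → SkeletonJ1` — the ∃-side got STRONGER;
* `transverseReduction1AG_of_1A : TransverseReduction1A → TransverseReduction1AG` — the ∀-side got WEAKER;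
* hence any line for the aside `TransverseReduction1A` (27414) is a line for the LIVE crux `TransverseReduction1AG` (27853); in
  particular the 21221-lane's sharp line `KelvinGate.TransverseReduction1A_of_sharp : DressedBase1A → EventualSharpGate1A →
  TransverseReduction1A` (p639443) composes with `transverseReduction1AG_of_1A`.

Proof texts: tenure planner ns-filament-repair-plan g14 scratch `weak1AG.lean` (sha16 fe4ce0d86d9f9bdf), landed verbatim by the
21221-p1 lane (g9) on the tenure ruling (α) of 2026-08-28T14:09:31Z, `--supports stmt-NavierStokesRegularity-27853 --as helper`.
HONEST FRAMING: pure logic between statements of a MODEL route (negative side of a rotated-self-similar blow-up scenario); no crux is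
proved or refuted here; nothing in this file bears on Navier–Stokes regularity.
-/

set_option linter.dupNamespace false

namespace Summit.NavierStokesRegularity.NavierStokesRegularity.Theorems

open Summit.NavierStokesRegularity.NavierStokesRegularity.Theses.FilamentSkeletonRss

/-- Clause monotonicity on the ∃-side: an A1G skeleton family (with the Γ-flat cone bound (d7)) is an A1α skeleton family
(drop the 14th conjunct of the clause block). [folklore] -/
theorem skeletonJ1_of_J1G (h : SkeletonJ1G) : SkeletonJ1 := by
  obtain ⟨N, δ, ρ, K, Λ, a, b, cnd, η, Rw, Rb, cg, θ₀, KA, Γ₂, hN, hδ, hρ, ha, hcnd, hη, hRw, hRb,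
    hcg, hθ₀, hΓ⟩ := h
  refine ⟨N, δ, ρ, K, Λ, a, b, cnd, η, Rw, Rb, cg, θ₀, Γ₂, hN, hδ, hρ, ha, hcnd, hη, hRw, hRb, hcg,
    hθ₀, fun Γ hΓ₂ => ?_⟩
  obtain ⟨γ, α, X, w, c, m, n, Aa, hsk⟩ := hΓ Γ hΓ₂
  refine ⟨γ, α, X, w, c, m, n, Aa, fun u v A T hu hv hA hT => ?_⟩
  obtain ⟨h1, h2, h3, h4, h5, h6, h7, h8, h9, h10, h11, h12, h13, -, h15, h16⟩ :=
    hsk u v A T hu hv hA hT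
  exact ⟨h1, h2, h3, h4, h5, h6, h7, h8, h9, h10, h11, h12, h13, h15, h16⟩

/-- Clause monotonicity on the ∀-side: the A1G transverse reduction (skeletons WITH the Γ-flat cone bound (d7)) follows from the
A1α transverse reduction (all skeletons) — one more hypothesis, weaker statement. [folklore] -/
theorem transverseReduction1AG_of_1A (h : TransverseReduction1A) : TransverseReduction1AG := by
  intro N δ ρ K Λ a b cnd η Rw Rb cg θ₀ KA hN hδ hρ ha hη hRw hRb hcg hθ₀
  obtain ⟨Γ₁, hΓ₁⟩ := h N δ ρ K Λ a b cnd η Rw Rb cg θ₀ hN hδ hρ ha hη hRw hRb hcg hθ₀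
  refine ⟨Γ₁, fun Γ hΓ γ α X w c m n Aa u v A T hu hv hA hT hsk => ?_⟩
  obtain ⟨h1, h2, h3, h4, h5, h6, h7, h8, h9, h10, h11, h12, h13, -, h15, h16⟩ := hsk
  exact hΓ₁ Γ hΓ γ α X w c m n Aa u v A T hu hv hA hT
    ⟨h1, h2, h3, h4, h5, h6, h7, h8, h9, h10, h11, h12, h13, h15, h16⟩

end Summit.NavierStokesRegularity.NavierStokesRegularity.Theorems
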